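import Summits.CriticalPhenomena.Ising3D.Control2DFourPointBounds
import Summits.CriticalPhenomena.Ising3D.Control2DChiralEnvelope
import Mathlib.Analysis.SpecialFunctions.Pow.Real
import Mathlib.Tactic.Linarith
import Mathlib.Tactic.Positivity
import Mathlib.Tactic.Ring
import Mathlib.Tactic.FieldSimp
import HarnessLib

/-!
# Crossing at `Δ_σ > 0` forces quasi-primaries of unbounded dimension
(cell `pub-ising3x`, seat controls-1 gen 43; PAPER §6.2 / Appendix E — CONTROL-ONLY; part 2 of 2, part 1 is
`Control2DChiralEnvelope`)

HONEST FRAMING: lottery ticket; floor = tightest certified 3D Ising CFT bounds; no exact-solution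
claim without a proof. CONTROL-ONLY (`d = 2`, global `sl(2) × sl(2)` blocks, `Δ_σ = s` an INPUT, axiom set
`A2D′`); nothing here is about `d = 3`, no certificate, functional or number of the record is touched, and no
new hypothesis or named fact enters.

WHAT THIS FILE ADDS. The typed hypothesis class (`CrossingData.IsUnitary` + `SatisfiesCrossing s`,
`Control2DBootstrap`) says nothing about the SIZE of the spectrum. Crossing symmetry does: the identity operator
in the crossed channel makes the four-point function blow up like a POWER at the boundary of the square,
`G(x,x) ≥ (x/(1-x))^{2s}` on the diagonal (`fourPoint_lower`, `Control2DFourPointBounds`), while every single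
global block grows slower than any power there (logarithmically, in truth). Hence:

* **The envelope (E), part 1 (`Control2DChiralEnvelope`).** For every `H` and every `ε > 0` there is `K ≥ 0` with
  `k_{2h}(x) ≤ K/(1-x)^ε` for all `0 ≤ h ≤ H`, `0 < x < 1` (coefficient domination against the binomial series);
  on the diagonal, for unitary labels `ℓ ≤ Δ ≤ H`: `2x^Δ ≤ g_{Δ,ℓ}(x,x) ≤ 2 (K/(1-x)^ε)²`
  (`two_mul_rpow_le_globalBlock_diag`, `exists_globalBlock_diag_le_envelope`).
* **No bounded effective spectrum (U).** `CrossingData.exists_nonzero_above`: a unitary solution of the typed sum rule at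
  `Δ_σ = s > 0` with convergent expansion (`OpeConvergent` — a THEOREM of every typed statement class of the
  record, `Control2DFourPoint`) has, above EVERY `H`, a label with `p_i ≠ 0`; `infinite_above`: the set
  `{i | p_i ≠ 0 ∧ Δ_i > H}` is infinite. (If all non-zero coefficients sat at `Δ_i ≤ H`: `Σ p_i < ∞` from
  convergence at `(1/2,1/2)` (`summable_p_of_bounded`), `G(x,x) ≤ 1 + 2K²(Σp)(1-x)^{-s}` with `ε = s/2`
  (`fourPoint_diag_le_of_bounded`), contradicting the crossing lower bound at an explicit point `x = 1 - t`.)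
  Branches with the convergence clause discharged: `infinite_above_of_lowerBound` (`Δ_i ≥ τ₀ > 2s`),
  `_of_hasScalarGap` (`U > 2s`, `s < 1`), `_of_location` (scalars in `{x₀} ∪ [G,∞)`, `x₀, G > 2s`, `s < 1`).
* **The hypothesis-free corollary (F).** `CrossingData.infinite_support`: EVERY unitary solution of the typed sum
  rule at `Δ_σ = s > 0` has infinitely many non-zero squared OPE coefficients — no finite non-negative combination
  of global blocks is crossing symmetric (finite support ⇒ convergent ⇒ (U)); `infinite_index`. Sharp in `s`:
  at `s = 0` a datum with empty index type is a unitary solution (`satisfiesCrossing_zero_of_isEmpty`).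
* **The record (R).** `record_unbounded_spectrum (w)`: every typed `A2D′` datum of the record's class at
  `Δ_σ = 1/8` (scalars `{x} ∪ [2,∞)`, spin 2 in `{2} ∪ [3,∞)`, `w ≤ x`; `x > 0.99` by `twoSided_2d_kernel099`)
  has `σ × σ` quasi-primaries of arbitrarily high dimension with non-zero OPE coefficient; the two witnesses
  `isingData2D` (E.1e) and `gffData2D s` (E.1c) likewise.

NOT claimed: anything about SPIN (no large-spin / lightcone statement: a tower of scalars is not excluded here);
any rate, density or accumulation point of the spectrum (no double-twist asymptotics, no Cardy-type growth); OPE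
convergence for typed data with a scalar location `x₀ ≤ 2s`; the logarithmic (true) growth of `k_{2h}` — only the
`ε`-power envelope is proved and used; Virasoro symmetry; anything three-dimensional; any new bound; no
certificate / functional / number of the record touched.

References: R. Rattazzi, V. S. Rychkov, E. Tonni, A. Vichi, JHEP 12 (2008) 031, §3 eq. (3.3)–(3.6) (crossing and
the sum rule) [cite: RattazziEtAl2008, §3]; F. A. Dolan, H. Osborn, Nucl. Phys. B 678 (2004) 491, §3 (the `ε = 0`
blocks `x^h ₂F₁(h,h;2h;x)`) [cite: DolanOsborn2004, §3]. Context only (not used, `d ≥ 3`, about SPIN): the lightcone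
argument that the identity in the crossed channel forces infinitely many large-spin operators — A. L. Fitzpatrick,
J. Kaplan, D. Poland, D. Simmons-Duffin, JHEP 12 (2013) 004; Z. Komargodski, A. Zhiboedov, JHEP 11 (2013) 140. The
elementary DIMENSION statement for global `d = 2` blocks with its `ε`-envelope was not located in print (presearch
in the cell's KP28/README) and is recorded as folklore. Tree: `two_mul_rpow_le_globalBlock_diag`, `exists_globalBlock_diag_le_envelope`
(`Control2DChiralEnvelope`, part 1); `OpeConvergent`, `fourPoint`,
`opeConvergent_of_lowerBound/_of_hasScalarGap/_of_location` (`Control2DFourPoint`); `fourPoint_lower`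
(`Control2DFourPointBounds`); `record_fourPoint_crossing`, `isingData2D_opeConvergent`, `gffData2D_opeConvergent`
(`Control2DParityConverse`); `isingData2D_isUnitary/_satisfiesCrossing` (`Control2DIsingData`),
`gffData2D_isUnitary/_satisfiesCrossing` (`Control2DNonVacuity`). Mathlib: `hasSum_le`, `Summable.of_nonneg_of_le`, `summable_of_ne_finset_zero`, `hasSum_empty`,
`Set.Finite.bddAbove`, `Set.Infinite.mono`, `Set.Infinite.to_subtype`, `Infinite.of_injective`,
`Real.rpow_le_rpow`, `Real.rpow_le_rpow_of_exponent_ge`, `Real.mul_rpow`, `Real.rpow_mul`.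
-/

namespace Summit.CriticalPhenomena.Ising3D.Control2D

open Set
open Literature.MathematicalPhysics.QuantumFieldTheory.ConformalBootstrap3D

/-! ### No bounded effective spectrum -/

namespace CrossingData

variable {D : CrossingData} {s : ℝ}

/-- **Bounded effective spectrum ⇒ summable OPE coefficients.** If every label with `p_i ≠ 0` has `Δ_i ≤ H` and
the expansion converges at `(1/2,1/2)`, then `Σ p_i < ∞` (each such block is `≥ 2 (1/2)^{Δ_i} ≥ 2 (1/2)^H` there).
[folklore] -/
theorem summable_p_of_bounded (hU : D.IsUnitary) (hconv : D.OpeConvergent) {H : ℝ}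
    (hB : ∀ i, D.p i ≠ 0 → D.Δ i ≤ H) : Summable D.p := by
  have hhalf : (1 / 2 : ℝ) ∈ Ioo (0 : ℝ) 1 := ⟨by norm_num, by norm_num⟩
  have hS := hconv (1 / 2) (1 / 2) hhalf hhalf
  have hc0 : 0 < 2 * (1 / 2 : ℝ) ^ H := by positivity
  refine (hS.mul_left (2 * (1 / 2 : ℝ) ^ H)⁻¹).of_nonneg_of_le (fun i => (hU i).2.2) fun i => ?_
  by_cases hp : D.p i = 0
  · simp [hp]
  · have hΔ := hB i hp
    have hg : 2 * (1 / 2 : ℝ) ^ H ≤ globalBlock (D.Δ i) (D.spin i) (1 / 2) (1 / 2) := by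
      have h1 := two_mul_rpow_le_globalBlock_diag (hU i).2.1 (x := 1 / 2) (by norm_num) (by norm_num)
      have h2 : (1 / 2 : ℝ) ^ H ≤ (1 / 2 : ℝ) ^ D.Δ i :=
        Real.rpow_le_rpow_of_exponent_ge (by norm_num) (by norm_num) hΔ
      linarith
    have hp0 : 0 ≤ D.p i := (hU i).2.2
    calc D.p i = (2 * (1 / 2 : ℝ) ^ H)⁻¹ * (D.p i * (2 * (1 / 2 : ℝ) ^ H)) := by
          field_simp
      _ ≤ (2 * (1 / 2 : ℝ) ^ H)⁻¹ * (D.p i * globalBlock (D.Δ i) (D.spin i) (1 / 2) (1 / 2)) :=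
          mul_le_mul_of_nonneg_left (mul_le_mul_of_nonneg_left hg hp0) (inv_nonneg.mpr hc0.le)

/-- **The diagonal upper bound under a bounded effective spectrum**: if every label with `p_i ≠ 0` has `Δ_i ≤ H`
and `K` is an envelope constant for `[0, H]` (`exists_globalBlock_diag_le_envelope H ε`), then
`G(x,x) ≤ 1 + 2 (K/(1-x)^ε)² · Σ_i p_i` on `(0,1)`. [folklore] -/
theorem fourPoint_diag_le_of_bounded (hU : D.IsUnitary) (hconv : D.OpeConvergent) {H ε K : ℝ}
    (hB : ∀ i, D.p i ≠ 0 → D.Δ i ≤ H)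
    (hK : ∀ (Δ : ℝ) (ℓ : ℕ), (ℓ : ℝ) ≤ Δ → Δ ≤ H → ∀ x : ℝ, 0 < x → x < 1 →
      globalBlock Δ ℓ x x ≤ 2 * (K / (1 - x) ^ ε) ^ 2)
    (hP : Summable D.p) {x : ℝ} (hx0 : 0 < x) (hx1 : x < 1) :
    D.fourPoint x x ≤ 1 + 2 * (K / (1 - x) ^ ε) ^ 2 * ∑' i, D.p i := by
  have hx : x ∈ Ioo (0 : ℝ) 1 := ⟨hx0, hx1⟩
  have hle : ∀ i, D.p i * globalBlock (D.Δ i) (D.spin i) x x ≤ D.p i * (2 * (K / (1 - x) ^ ε) ^ 2) := by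
    intro i
    by_cases hp : D.p i = 0
    · simp [hp]
    · exact mul_le_mul_of_nonneg_left (hK _ _ (hU i).2.1 (hB i hp) x hx0 hx1) (hU i).2.2
  have h := hasSum_le hle (hconv x x hx hx).hasSum (hP.hasSum.mul_right _)
  have hcomm : (∑' i, D.p i) * (2 * (K / (1 - x) ^ ε) ^ 2) = 2 * (K / (1 - x) ^ ε) ^ 2 * ∑' i, D.p i :=
    mul_comm _ _
  unfold fourPoint
  linarith [h, hcomm]

/-- **No bounded effective spectrum (crossing forces arbitrarily heavy quasi-primaries).** A unitary solution of
the typed `⟨σσσσ⟩` sum rule at `Δ_σ = s > 0` whose `s`-channel expansion converges on the open square has, above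
EVERY `H`, a label with non-zero squared OPE coefficient. Crossing gives `G(x,x) ≥ (x/(1-x))^{2s}` on the diagonal
(`fourPoint_lower`: the identity in the crossed channel), a spectrum bounded by `H` gives
`G(x,x) ≤ 1 + 2K² (Σp) (1-x)^{-s}` (the envelope with `ε = s/2`), and the two are incompatible at
`x = 1 - t`, `t = min(1/2, (q/2M)^{1/s})`, `q = (1/4)^s`, `M = 2K² Σp + 1`. [folklore] -/
theorem exists_nonzero_above (hU : D.IsUnitary) (hC : D.SatisfiesCrossing s) (hs : 0 < s) (hconv : D.OpeConvergent)
    (H : ℝ) : ∃ i, D.p i ≠ 0 ∧ H < D.Δ i := by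
  by_contra hneg
  push Not at hneg
  have hε : 0 < s / 2 := by linarith
  obtain ⟨K, hK0, hK⟩ := exists_globalBlock_diag_le_envelope H hε
  have hP := summable_p_of_bounded hU hconv hneg
  set P : ℝ := ∑' i, D.p i with hPdef
  have hP0 : 0 ≤ P := tsum_nonneg fun i => (hU i).2.2
  set M : ℝ := 2 * K ^ 2 * P + 1 with hMdef
  have hM0 : 0 < M := by positivity
  set q : ℝ := (1 / 4 : ℝ) ^ s with hqdef
  have hq0 : 0 < q := by positivity
  set t : ℝ := min (1 / 2) ((q / (2 * M)) ^ (1 / s)) with htdef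
  have ht0 : 0 < t := lt_min (by norm_num) (Real.rpow_pos_of_pos (by positivity) _)
  have ht2 : t ≤ 1 / 2 := min_le_left _ _
  have hts : t ^ s ≤ q / (2 * M) := by
    have h1 : t ^ s ≤ ((q / (2 * M)) ^ (1 / s)) ^ s :=
      Real.rpow_le_rpow ht0.le (min_le_right _ _) hs.le
    rw [← Real.rpow_mul (by positivity), one_div_mul_cancel hs.ne', Real.rpow_one] at h1
    exact h1
  have hts0 : 0 < t ^ s := Real.rpow_pos_of_pos ht0 s
  -- the comparison point `x = 1 - t ∈ [1/2, 1)`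
  have hx0 : 0 < 1 - t := by linarith
  have hx1 : 1 - t < 1 := by linarith
  have hx : (1 - t) ∈ Ioo (0 : ℝ) 1 := ⟨hx0, hx1⟩
  have hlow := fourPoint_lower hU hC hconv hx hx
  have hup := fourPoint_diag_le_of_bounded hU hconv hneg hK hP hx0 hx1
  rw [← hPdef] at hup
  rw [sub_sub_cancel] at hlow hup
  have hxs : (1 / 2 : ℝ) ^ s ≤ (1 - t) ^ s := Real.rpow_le_rpow (by norm_num) (by linarith) hs.le
  have hxx : ((1 - t) * (1 - t)) ^ s = (1 - t) ^ s * (1 - t) ^ s := Real.mul_rpow hx0.le hx0.le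
  have htt : (t * t) ^ s = t ^ s * t ^ s := Real.mul_rpow ht0.le ht0.le
  have hq' : q = (1 / 2 : ℝ) ^ s * (1 / 2 : ℝ) ^ s := by
    rw [hqdef, ← Real.mul_rpow (by norm_num) (by norm_num)]; norm_num
  have hKt : (K / t ^ (s / 2)) ^ 2 = K ^ 2 / t ^ s := by
    rw [div_pow, ← Real.rpow_natCast (t ^ (s / 2)) 2, ← Real.rpow_mul ht0.le]
    rw [show s / 2 * ((2 : ℕ) : ℝ) = s by push_cast; ring]
  rw [hKt] at hup
  -- assemble: `q ≤ x^s x^s ≤ t^s t^s (1 + 2K²/t^s · P) = t^s (t^s + 2K² P) ≤ t^s M ≤ q/2`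
  have hA : q ≤ (1 - t) ^ s * (1 - t) ^ s := by
    rw [hq']; exact mul_le_mul hxs hxs (by positivity) (by positivity)
  have hB : (1 - t) ^ s * (1 - t) ^ s ≤ t ^ s * t ^ s * (1 + 2 * (K ^ 2 / t ^ s) * P) := by
    rw [← hxx, ← htt]
    calc ((1 - t) * (1 - t)) ^ s ≤ (t * t) ^ s * D.fourPoint (1 - t) (1 - t) := hlow
      _ ≤ (t * t) ^ s * (1 + 2 * (K ^ 2 / t ^ s) * P) :=
          mul_le_mul_of_nonneg_left hup (Real.rpow_nonneg (mul_pos ht0 ht0).le s)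
  have hC' : t ^ s * t ^ s * (1 + 2 * (K ^ 2 / t ^ s) * P) = t ^ s * (t ^ s + 2 * K ^ 2 * P) := by
    field_simp
  have hts1 : t ^ s ≤ 1 := Real.rpow_le_one ht0.le (by linarith) hs.le
  have hD : t ^ s * (t ^ s + 2 * K ^ 2 * P) ≤ t ^ s * M := by
    apply mul_le_mul_of_nonneg_left _ hts0.le
    rw [hMdef]; linarith
  have hE : t ^ s * M ≤ q / (2 * M) * M := mul_le_mul_of_nonneg_right hts hM0.le
  have hF : q / (2 * M) * M = q / 2 := by
    field_simp
  linarith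

/-- **Infinitely many labels above every bound.** Under the same hypotheses, for every `H` the set
`{i | p_i ≠ 0 ∧ Δ_i > H}` is INFINITE (a finite one has a largest dimension `B`; apply `exists_nonzero_above` above
`max H B`). [folklore] -/
theorem infinite_above (hU : D.IsUnitary) (hC : D.SatisfiesCrossing s) (hs : 0 < s) (hconv : D.OpeConvergent)
    (H : ℝ) : {i | D.p i ≠ 0 ∧ H < D.Δ i}.Infinite := by
  intro hfin
  obtain ⟨B, hB⟩ := (hfin.image D.Δ).bddAbove
  obtain ⟨i, hp, hH⟩ := exists_nonzero_above hU hC hs hconv (max H B)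
  have hi : i ∈ {i | D.p i ≠ 0 ∧ H < D.Δ i} := ⟨hp, lt_of_le_of_lt (le_max_left _ _) hH⟩
  have hle : D.Δ i ≤ B := hB (Set.mem_image_of_mem D.Δ hi)
  have := le_max_right H B
  linarith

/-- Under a uniform lower bound `Δ_i ≥ τ₀ > 2s` (`0 < s`) the convergence hypothesis is a theorem
(`opeConvergent_of_lowerBound`): infinitely many non-zero OPE coefficients above every bound. [folklore] -/
theorem infinite_above_of_lowerBound (hU : D.IsUnitary) (hC : D.SatisfiesCrossing s) (hs : 0 < s) {τ₀ : ℝ}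
    (hτ : ∀ i, τ₀ ≤ D.Δ i) (hτ₀ : 2 * s < τ₀) (H : ℝ) : {i | D.p i ≠ 0 ∧ H < D.Δ i}.Infinite :=
  infinite_above hU hC hs (opeConvergent_of_lowerBound hU hC hτ hτ₀) H

/-- In the branch of a gap statement (`HasScalarGap U`, `U > 2s`, `0 < s < 1`): infinitely many non-zero OPE
coefficients above every bound. [folklore] -/
theorem infinite_above_of_hasScalarGap (hU : D.IsUnitary) (hC : D.SatisfiesCrossing s) (hs : 0 < s) {U : ℝ}
    (hgap : D.HasScalarGap U) (hU2 : 2 * s < U) (hs1 : s < 1) (H : ℝ) :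
    {i | D.p i ≠ 0 ∧ H < D.Δ i}.Infinite :=
  infinite_above hU hC hs (opeConvergent_of_hasScalarGap hU hC hgap hU2 hs1) H

/-- In the branch of a single-location statement (scalars in `{x₀} ∪ [G,∞)`, `x₀, G > 2s`, `0 < s < 1`):
infinitely many non-zero OPE coefficients above every bound. [folklore] -/
theorem infinite_above_of_location (hU : D.IsUnitary) (hC : D.SatisfiesCrossing s) (hs : 0 < s) {x₀ G : ℝ}
    (hS : D.ScalarsIn ({x₀} ∪ Ici G)) (hx : 2 * s < x₀) (hG : 2 * s < G) (hs1 : s < 1) (H : ℝ) :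
    {i | D.p i ≠ 0 ∧ H < D.Δ i}.Infinite :=
  infinite_above hU hC hs (opeConvergent_of_location hU hC hS hx hG hs1) H

/-! ### The hypothesis-free corollary: infinitely many non-zero OPE coefficients -/

/-- Data with finitely many non-zero squared OPE coefficients have (trivially) convergent expansion. [folklore] -/
theorem opeConvergent_of_finite_support (hfin : {i | D.p i ≠ 0}.Finite) : D.OpeConvergent := by
  intro z zb _ _
  apply summable_of_ne_finset_zero (s := hfin.toFinset)
  intro i hi
  have hp : D.p i = 0 := by
    by_contra h
    exact hi (hfin.mem_toFinset.mpr h)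
  simp [hp]

/-- **Every unitary solution of the typed sum rule at `Δ_σ > 0` has infinitely many non-zero squared OPE
coefficients**: NO finite combination of global `sl(2) × sl(2)` blocks with non-negative coefficients is crossing
symmetric (finite support ⇒ convergent expansion ⇒ `infinite_above`). No convergence or gap hypothesis.
(For `s = 0` the statement is false: the empty datum solves the sum rule, `F_-[1] ≡ 0`.) [folklore] -/
theorem infinite_support (hU : D.IsUnitary) (hC : D.SatisfiesCrossing s) (hs : 0 < s) :
    {i | D.p i ≠ 0}.Infinite := fun hfin =>
  (infinite_above hU hC hs (opeConvergent_of_finite_support hfin) 0).mono (fun _ hi => hi.1) hfin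

/-- In particular the index type of every unitary typed solution at `Δ_σ > 0` is infinite. [folklore] -/
theorem infinite_index (hU : D.IsUnitary) (hC : D.SatisfiesCrossing s) (hs : 0 < s) : Infinite D.ι := by
  have h := (infinite_support hU hC hs).to_subtype
  exact Infinite.of_injective (fun i : {i | D.p i ≠ 0} => (i : D.ι)) Subtype.val_injective

/-- Sharpness in `s`, part (a): a datum with EMPTY index type is (vacuously) unitary. [folklore] -/
theorem isUnitary_of_isEmpty (D : CrossingData) [IsEmpty D.ι] : D.IsUnitary := fun i => isEmptyElim i

/-- Sharpness in `s`, part (b): a datum with empty index type solves the typed sum rule at `s = 0`, where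
`F_-[1] = v^0 - u^0 ≡ 0` — so the hypothesis `0 < s` of `infinite_support` cannot be dropped. [folklore] -/
theorem satisfiesCrossing_zero_of_isEmpty (D : CrossingData) [IsEmpty D.ι] : D.SatisfiesCrossing 0 := by
  intro z zb _ _
  have h0 : -(crossF 0 (-1) (fun _ _ => (1 : ℝ)) z zb) = 0 := by
    simp [crossF, Real.rpow_zero]
  rw [h0]
  exact hasSum_empty

end CrossingData

/-! ### The record's class at `Δ_σ = 1/8` and the two witnesses -/

/-- **Every typed `A2D′` datum of the record's class at `Δ_σ = 1/8` has `σ × σ` quasi-primaries of arbitrarily high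
dimension with non-zero OPE coefficient** (scalars `{x} ∪ [2,∞)`, spin 2 in `{2} ∪ [3,∞)`, `w ≤ x`: the record puts
`x > 0.99 > 1/4 = 2Δ_σ`, so the expansion converges, `record_fourPoint_crossing`). CONTROL-ONLY; no number of the
record is touched. [folklore] -/
theorem record_unbounded_spectrum (w : ℝ) (D : CrossingData) (hU : D.IsUnitary)
    (hC : D.SatisfiesCrossing (1 / 8)) (hT : D.SpinTwoIn ({2} ∪ Ici (2 + 1))) (x : ℝ) (hwx : w ≤ x)
    (hS : D.ScalarsIn ({x} ∪ Ici 2)) (H : ℝ) : {i | D.p i ≠ 0 ∧ H < D.Δ i}.Infinite :=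
  CrossingData.infinite_above hU hC (by norm_num) (record_fourPoint_crossing w D hU hC hT x hwx hS).1 H

/-- The 2D Ising datum of E.1e has non-zero OPE coefficients above every bound (here a consequence of crossing
alone; its explicit spectrum of course shows it directly). [folklore] -/
theorem isingData2D_unbounded_spectrum (H : ℝ) :
    {i | isingData2D.p i ≠ 0 ∧ H < isingData2D.Δ i}.Infinite :=
  CrossingData.infinite_above isingData2D_isUnitary isingData2D_satisfiesCrossing (by norm_num)
    isingData2D_opeConvergent H

/-- The generalised-free witness of E.1c at any `s > 0` has non-zero OPE coefficients above every bound. [folklore] -/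
theorem gffData2D_unbounded_spectrum {s : ℝ} (hs : 0 < s) (H : ℝ) :
    {i | (gffData2D s).p i ≠ 0 ∧ H < (gffData2D s).Δ i}.Infinite :=
  CrossingData.infinite_above (gffData2D_isUnitary hs) (gffData2D_satisfiesCrossing hs) hs
    (gffData2D_opeConvergent hs) H

end Summit.CriticalPhenomena.Ising3D.Control2D
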